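import Summits.BirchSwinnertonDyer.BirchSwinnertonDyer.Theorems.ManinLocalTwoThreeNewformSeventyTwo
import Summits.BirchSwinnertonDyer.BirchSwinnertonDyer.Theorems.ManinLocalTwoThreeNewformThirtySix
import HarnessLib

/-!
# Level 72, newform part 2: the traces `S₂(Γ₀(72)) → S₂(Γ₀(36))` and `S₂(Γ₀(72)) → S₂(Γ₀(24))` kill the three `η`-quotients
# `h₁ = η₄⁴η₆²/η₂²`, `h₂ = η₂⁴η₁₂²/η₄²`, `h₃ = η₁₂⁴` — Dedekind's functional equation under `(1 0; 36 1)`, `(1 0; 24 1)`, `(1 0; 48 1)`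
# factor by factor — FACT-FREE

Cell bsd-f2-manin, route `ManinLocalTwoThree` (cruxes C2 stmt-22967 / C3 stmt-22968: `4 ∣ 72`, `9 ∣ 72`), prover seat p2 gen 27; sequel to
`…NewformSeventyTwo` (same namespace).  Because `h₁, h₂, h₃` are supported on the divisors of `12`, they factor BOTH as `u·f₂₄`
(`f₂₄ = η₂η₄η₆η₁₂`, `u` of weight `0` and level `24`) and as `u′·f₃₆` (`f₃₆ = η₆⁴`, `u′` of weight `0` and level `36`), and p2 g26's
level-free law `etaQuotient_smul_lowerUnipotent` (`g(W_Mτ) = e^{−(πi/12)Σ(M/δ)r_δ} g(τ)`, `W_M = (1 0; M 1)`) applies at `M = 36`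
(signs `−1`: `Σ(36/δ)r ≡ 12`), at `M = 24` and at `M = 48` (cube roots of unity: `Σ(24/δ)r ≡ ±8 (mod 24)`).

* §3 General: re-levelling of `η`-quotients along the support, products of `η`-quotients by exponent bookkeeping; the index-`2` trace
  `Tr₃₆ ψ = ψ + ψ|(1 0; 36 1)` kills every `ψ` with `ψ|W₃₆ = −ψ`; the index-`3` trace `Tr₂₄ψ = ψ + ψ|(1 0; 24 1) + ψ|(1 0; 48 1)` kills
  every `ψ` with `ψ|W₂₄ = c₁ψ`, `ψ|W₄₈ = c₂ψ`, `1 + c₁ + c₂ = 0` (tree `coe_adjDegeneracyMap0_one_eq_sum`).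
* §4 The laws: `h_i(W₃₆τ) = −(36τ+1)²h_i(τ)`, `f₂₄(W₃₆τ) = −(36τ+1)²f₂₄(τ)` (so **`Tr₃₆` kills `h₁, h₂, h₃` and `ι f₂₄`**);
  `h_i(W₂₄τ) = ω_i(24τ+1)²h_i(τ)`, `h_i(W₄₈τ) = ω_i²(48τ+1)²h_i(τ)` with `ω₁ = ω₃ = e^{4πi/3}`, `ω₂ = e^{−4πi/3}` (so **`Tr₂₄` kills
  `h₁, h₂, h₃`**).

The sequel `…NewformPinningSeventyTwo` pins `D.f = ⅔h₁ + ⅓h₂` for every `X₀(72)`-datum.  No definition, no named fact, no sorry.  Nothing here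
proves C2, C3, Manin's conjecture or BSD. [cite: Apostol1990, Thm. 3.4] [cite: RademacherGrosswald1972, Ch. 4 A] [cite: DiamondShurman2005, §5.1]
-/

set_option autoImplicit false
-- lint-debt: the directory name repeats the summit name (sibling precedent `ManinLocalTwoThreeNewformSeventyTwo.lean`)
set_option linter.dupNamespace false

noncomputable section

open Complex Filter Topology Set Function Asymptotics Polynomial
open UpperHalfPlane hiding I
open scoped Real Topology Manifold MatrixGroups ModularForm
open ModularForm CongruenceSubgroup Matrix.SpecialLinearGroup
open Literature.NumberTheory.ModularForms
open Literature.NumberTheory.EllipticCurves Literature.NumberTheory.EllipticCurves.ModularForms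

namespace Summit.BirchSwinnertonDyer.BirchSwinnertonDyer.Theorems.ManinLocalTwoThree.NewformSeventyTwo

open CuspToolkit
open NewformFortyEight (slash_mapGL)
open EtaQuotientLowerUnipotent (etaQuotient_smul_lowerUnipotent etaQuotient_smul_lowerUnipotent_of_mod)

/-! ## §3 General tools: re-levelling, products, and the two trace-killing criteria at level `72` -/

/-- **Re-levelling an `η`-quotient along its support**: if `M ∣ N` and the exponent list vanishes at the divisors of `N` that do not
divide `M`, the level-`N` and level-`M` products agree. [folklore] -/
theorem etaQuotient_eq_of_dvd_of_support {N M : ℕ} (hMN : M ∣ N) (hN : N ≠ 0) (L : List (ℕ × ℤ))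
    (h : ∀ t ∈ N.divisors, t ∉ M.divisors → expFn L t = 0) (τ : ℍ) :
    etaQuotient N (expFn L) τ = etaQuotient M (expFn L) τ := by
  rw [etaQuotient_apply, etaQuotient_apply]
  symm
  refine Finset.prod_subset (Nat.divisors_subset_of_dvd hN hMN) fun t ht hnt ↦ ?_
  rw [h t ht hnt, zpow_zero]

/-- **Products of `η`-quotients by exponent bookkeeping**: if `r(L) = r(L₁) + r(L₂)` on the divisors of `N`, then
`∏η^{r(L)} = ∏η^{r(L₁)} · ∏η^{r(L₂)}`. [folklore] -/
theorem etaQuotient_eq_mul_of_expFn (N : ℕ) (L L₁ L₂ : List (ℕ × ℤ)) (h : ∀ δ ∈ N.divisors, expFn L δ = expFn L₁ δ + expFn L₂ δ)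
    (τ : ℍ) : etaQuotient N (expFn L) τ = etaQuotient N (expFn L₁) τ * etaQuotient N (expFn L₂) τ := by
  rw [etaQuotient_apply, etaQuotient_apply, etaQuotient_apply, ← Finset.prod_mul_distrib]
  refine Finset.prod_congr rfl fun δ hδ ↦ ?_
  rw [h δ hδ, zpow_add₀ (eta_natMul_ne_zero (Nat.pos_of_mem_divisors hδ) τ.im_pos)]

/-- `f₂₄(Wτ) = (cτ + d)² f₂₄(τ)` for `W = (a b; c d) ∈ Γ₀(24)`. [folklore] -/
theorem f24_smul_of_mem (W : SL(2, ℤ)) (hW : W ∈ Gamma0 24) (τ : ℍ) :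
    cuspFormEta24 (W • τ) = (((W 1 0 : ℤ) : ℂ) * (τ : ℂ) + ((W 1 1 : ℤ) : ℂ)) ^ 2 * cuspFormEta24 τ := by
  have h := congr_fun (SlashInvariantForm.slash_action_eqn cuspFormEta24 _ ⟨W, hW, rfl⟩) τ
  rw [slash_mapGL, SL_slash_apply, ModularGroup.denom_apply] at h
  have hne := SL2_denom_ne_zero W τ
  rw [← h]
  field_simp

/-- `f₃₆(Wτ) = (cτ + d)² f₃₆(τ)` for `W ∈ Γ₀(36)`. [folklore] -/
theorem f36_smul_of_mem (W : SL(2, ℤ)) (hW : W ∈ Gamma0 36) (τ : ℍ) :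
    cuspFormEtaProductThirtySix (W • τ) = (((W 1 0 : ℤ) : ℂ) * (τ : ℂ) + ((W 1 1 : ℤ) : ℂ)) ^ 2 * cuspFormEtaProductThirtySix τ := by
  have h := congr_fun (SlashInvariantForm.slash_action_eqn cuspFormEtaProductThirtySix _ ⟨W, hW, rfl⟩) τ
  rw [slash_mapGL, SL_slash_apply, ModularGroup.denom_apply] at h
  have hne := SL2_denom_ne_zero W τ
  rw [← h]
  field_simp

/-- `W ∈ Γ₀(M)` from its lower-left entry. [folklore] -/
theorem mem_Gamma0_of_entry {M : ℕ} (W : SL(2, ℤ)) {c : ℤ} (h10 : W 1 0 = c) (hc : (M : ℤ) ∣ c) : W ∈ Gamma0 M := by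
  rw [Gamma0_mem, h10]
  exact (ZMod.intCast_zmod_eq_zero_iff_dvd c M).mpr hc

/-- **The index-`2` trace `S₂(Γ₀(72)) → S₂(Γ₀(36))` kills every cusp form negated by `W = (1 0; 36 1)`.**
[cite: DiamondShurman2005, §5.1 special case (3)] -/
theorem adjDegeneracyMap0_thirtySix_eq_zero_of_smul_W (ψ : CuspForm (Gamma0 72) 2)
    (hψ : ∀ W : SL(2, ℤ), W 0 0 = 1 → W 0 1 = 0 → W 1 0 = 36 → W 1 1 = 1 → ∀ τ : ℍ,
      ψ (W • τ) = -((36 * (τ : ℂ) + 1) ^ 2 * ψ τ)) :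
    adjDegeneracyMap0 72 36 1 2 ψ = 0 := by
  haveI : Fact (Nat.Prime 2) := ⟨Nat.prime_two⟩
  have h := coe_adjDegeneracyMap0_one_eq_sum 2 2 36 72 (by norm_num) (by norm_num) ψ
  apply DFunLike.ext
  intro τ
  have hτ := congr_fun h τ
  rw [Finset.sum_apply, Fin.sum_univ_two] at hτ
  rw [CuspForm.zero_apply, hτ]
  have h0 : (Matrix.SpecialLinearGroup.transpose (ModularGroup.T ^ ((36 : ℕ) * (((0 : Fin 2) : ℕ) : ℤ) : ℤ)) : SL(2, ℤ)) = 1 := by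
    ext i j
    fin_cases i <;> fin_cases j <;> simp [Matrix.SpecialLinearGroup.transpose]
  set X : SL(2, ℤ) := Matrix.SpecialLinearGroup.transpose (ModularGroup.T ^ ((36 : ℕ) * (((1 : Fin 2) : ℕ) : ℤ) : ℤ)) with hX
  have hX' : ∀ i j : Fin 2, X i j = !![(1 : ℤ), 0; 36, 1] i j := by
    intro i j
    rw [hX]
    fin_cases i <;> fin_cases j <;> simp [Matrix.SpecialLinearGroup.transpose, ModularGroup.coe_T_zpow]
  have h10 : X 1 0 = 36 := by simpa using hX' 1 0
  have h11 : X 1 1 = 1 := by simpa using hX' 1 1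
  rw [h0, map_one, SlashAction.slash_one, slash_mapGL, SL_slash_apply, ModularGroup.denom_apply, h10, h11,
    hψ X (by simpa using hX' 0 0) (by simpa using hX' 0 1) h10 h11 τ]
  push_cast
  have hne : (36 * (τ : ℂ) + 1) ≠ 0 := by
    have h2 := SL2_denom_ne_zero X τ
    rw [h10, h11] at h2
    push_cast at h2
    exact h2
  field_simp
  ring

/-- **The index-`3` trace `S₂(Γ₀(72)) → S₂(Γ₀(24))` kills every cusp form on which `W₂₄ = (1 0; 24 1)` and `W₄₈ = (1 0; 48 1)` act by
scalars `c₁, c₂` with `1 + c₁ + c₂ = 0`** (`Tr₂₄ψ = ψ + ψ|W₂₄ + ψ|W₄₈`). [cite: DiamondShurman2005, §5.1] -/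
theorem adjDegeneracyMap0_twentyFour_eq_zero_of_smul_W (ψ : CuspForm (Gamma0 72) 2) (c₁ c₂ : ℂ) (hc : 1 + c₁ + c₂ = 0)
    (hψ₁ : ∀ W : SL(2, ℤ), W 0 0 = 1 → W 0 1 = 0 → W 1 0 = 24 → W 1 1 = 1 → ∀ τ : ℍ,
      ψ (W • τ) = c₁ * (24 * (τ : ℂ) + 1) ^ 2 * ψ τ)
    (hψ₂ : ∀ W : SL(2, ℤ), W 0 0 = 1 → W 0 1 = 0 → W 1 0 = 48 → W 1 1 = 1 → ∀ τ : ℍ,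
      ψ (W • τ) = c₂ * (48 * (τ : ℂ) + 1) ^ 2 * ψ τ) :
    adjDegeneracyMap0 72 24 1 2 ψ = 0 := by
  haveI : Fact (Nat.Prime 3) := ⟨Nat.prime_three⟩
  have h := coe_adjDegeneracyMap0_one_eq_sum 2 3 24 72 (by norm_num) (by norm_num) ψ
  apply DFunLike.ext
  intro τ
  have hτ := congr_fun h τ
  rw [Finset.sum_apply, Fin.sum_univ_three] at hτ
  rw [CuspForm.zero_apply, hτ]
  have h0 : (Matrix.SpecialLinearGroup.transpose (ModularGroup.T ^ ((24 : ℕ) * (((0 : Fin 3) : ℕ) : ℤ) : ℤ)) : SL(2, ℤ)) = 1 := by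
    ext i j
    fin_cases i <;> fin_cases j <;> simp [Matrix.SpecialLinearGroup.transpose]
  set X : SL(2, ℤ) := Matrix.SpecialLinearGroup.transpose (ModularGroup.T ^ ((24 : ℕ) * (((1 : Fin 3) : ℕ) : ℤ) : ℤ)) with hX
  set Y : SL(2, ℤ) := Matrix.SpecialLinearGroup.transpose (ModularGroup.T ^ ((24 : ℕ) * (((2 : Fin 3) : ℕ) : ℤ) : ℤ)) with hY
  have hX' : ∀ i j : Fin 2, X i j = !![(1 : ℤ), 0; 24, 1] i j := by
    intro i j
    rw [hX]
    fin_cases i <;> fin_cases j <;> simp [Matrix.SpecialLinearGroup.transpose, ModularGroup.coe_T_zpow]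
  have hY' : ∀ i j : Fin 2, Y i j = !![(1 : ℤ), 0; 48, 1] i j := by
    intro i j
    rw [hY]
    fin_cases i <;> fin_cases j <;> simp [Matrix.SpecialLinearGroup.transpose, ModularGroup.coe_T_zpow]
  have hX10 : X 1 0 = 24 := by simpa using hX' 1 0
  have hX11 : X 1 1 = 1 := by simpa using hX' 1 1
  have hY10 : Y 1 0 = 48 := by simpa using hY' 1 0
  have hY11 : Y 1 1 = 1 := by simpa using hY' 1 1
  have hX1 : (⇑ψ ∣[(2 : ℤ)] X) τ = c₁ * ψ τ := by
    rw [SL_slash_apply, ModularGroup.denom_apply, hX10, hX11, hψ₁ X (by simpa using hX' 0 0) (by simpa using hX' 0 1) hX10 hX11 τ]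
    push_cast
    have hne : (24 * (τ : ℂ) + 1) ≠ 0 := by
      have h2 := SL2_denom_ne_zero X τ
      rw [hX10, hX11] at h2
      push_cast at h2
      exact h2
    field_simp
  have hY1 : (⇑ψ ∣[(2 : ℤ)] Y) τ = c₂ * ψ τ := by
    rw [SL_slash_apply, ModularGroup.denom_apply, hY10, hY11, hψ₂ Y (by simpa using hY' 0 0) (by simpa using hY' 0 1) hY10 hY11 τ]
    push_cast
    have hne : (48 * (τ : ℂ) + 1) ≠ 0 := by
      have h2 := SL2_denom_ne_zero Y τ
      rw [hY10, hY11] at h2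
      push_cast at h2
      exact h2
    field_simp
  rw [h0, map_one, SlashAction.slash_one, slash_mapGL, slash_mapGL, hX1, hY1]
  linear_combination ψ τ * hc

/-- **`1 + e^{−πis/12} + e^{−2πis/12} = 0` for `s ≡ ±8 (mod 24)`** (the two primitive cube roots of unity). [folklore] -/
theorem one_add_cexp_add_cexp_eq_zero (s : ℤ) (hs : (24 : ℤ) ∣ s - 8 ∨ (24 : ℤ) ∣ s - 16) :
    1 + cexp (-(π * I / 12 * (s : ℂ))) + cexp (-(π * I / 12 * ((2 * s : ℤ) : ℂ))) = 0 := by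
  -- `ζ = e^{−πis/12}` satisfies `ζ³ = 1`, `ζ ≠ 1`
  set ζ : ℂ := cexp (-(π * I / 12 * (s : ℂ))) with hζ
  have h2 : cexp (-(π * I / 12 * ((2 * s : ℤ) : ℂ))) = ζ ^ 2 := by
    rw [hζ, ← Complex.exp_nat_mul]
    congr 1
    push_cast
    ring
  obtain ⟨k, hk, hk3⟩ : ∃ k : ℤ, s = 8 * k ∧ ¬ (3 : ℤ) ∣ k := by
    rcases hs with ⟨m, hm⟩ | ⟨m, hm⟩
    · exact ⟨3 * m + 1, by omega, by omega⟩
    · exact ⟨3 * m + 2, by omega, by omega⟩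
  have h3 : ζ ^ 3 = 1 := by
    rw [hζ, ← Complex.exp_nat_mul, hk]
    have : ((3 : ℕ) : ℂ) * -(π * I / 12 * ((8 * k : ℤ) : ℂ)) = (-k : ℤ) * (2 * π * I) := by push_cast; ring
    rw [this, Complex.exp_int_mul_two_pi_mul_I]
  have h1 : ζ ≠ 1 := by
    rw [hζ, Ne, Complex.exp_eq_one_iff]
    rintro ⟨n, hn⟩
    rw [hk] at hn
    have hπ : (2 * π * I : ℂ) ≠ 0 := by simp [Real.pi_ne_zero, I_ne_zero]
    have hkn : ((-k : ℤ) : ℂ) = ((3 * n : ℤ) : ℂ) := by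
      have : ((-k : ℤ) : ℂ) * (2 * π * I) = ((3 * n : ℤ) : ℂ) * (2 * π * I) := by
        push_cast at hn ⊢
        linear_combination 3 * hn
      exact mul_right_cancel₀ hπ this
    exact hk3 ⟨-n, by have := (Int.cast_injective (α := ℂ)) hkn; omega⟩
  rw [h2]
  have hfac : (ζ - 1) * (1 + ζ + ζ ^ 2) = 0 := by linear_combination h3
  rcases mul_eq_zero.mp hfac with h | h
  · exact absurd (sub_eq_zero.mp h) h1
  · exact h

/-! ## §4 The laws for `h₁, h₂, h₃` (and `f₂₄`) under `W₃₆`, `W₂₄`, `W₄₈` -/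

section W36

variable (W : SL(2, ℤ)) (h00 : W 0 0 = 1) (h01 : W 0 1 = 0) (h10 : W 1 0 = 36) (h11 : W 1 1 = 1)
include h00 h01 h10 h11

/-- The `W₃₆`-law for an `η`-quotient `h = u′·η₆⁴` of level `72` supported on the divisors of `12`, with `u′` of log period `½`:
`h(W₃₆τ) = −(36τ+1)²h(τ)`. [cite: Apostol1990, Thm. 3.4] -/
theorem smul_W36_of_factor (L Lu : List (ℕ × ℤ)) (hL : ∀ t ∈ Nat.divisors 72, t ∉ Nat.divisors 36 → expFn L t = 0)
    (hmul : ∀ δ ∈ Nat.divisors 36, expFn L δ = expFn Lu δ + expFn [(6, 4)] δ)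
    (hsum : ∑ t ∈ Nat.divisors 36, expFn Lu t = 0) (h12 : (24 : ℤ) ∣ (∑ t ∈ Nat.divisors 36, ((36 / t : ℕ) : ℤ) * expFn Lu t) - 12)
    (τ : ℍ) : etaQuotient 72 (expFn L) (W • τ) = -((36 * (τ : ℂ) + 1) ^ 2 * etaQuotient 72 (expFn L) τ) := by
  have hW : W ∈ Gamma0 36 := mem_Gamma0_of_entry W h10 ⟨1, by norm_num⟩
  rw [etaQuotient_eq_of_dvd_of_support (by norm_num : 36 ∣ 72) (by norm_num) L hL,
    etaQuotient_eq_of_dvd_of_support (by norm_num : 36 ∣ 72) (by norm_num) L hL,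
    etaQuotient_eq_mul_of_expFn 36 L Lu [(6, 4)] hmul, etaQuotient_eq_mul_of_expFn 36 L Lu [(6, 4)] hmul,
    NewformThirtySix.etaQuotient_six_eq_etaProductThirtySix, NewformThirtySix.etaQuotient_six_eq_etaProductThirtySix,
    show etaProductThirtySix (W • τ) = cuspFormEtaProductThirtySix (W • τ) from rfl,
    show etaProductThirtySix τ = cuspFormEtaProductThirtySix τ from rfl, f36_smul_of_mem W hW, h10, h11,
    etaQuotient_smul_lowerUnipotent_of_mod 36 (by norm_num) _ hsum h12 W h00 h01 h10 h11 τ]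
  push_cast
  ring

/-- **`h₁(W₃₆τ) = −(36τ+1)²h₁(τ)`** (`u′ = η₄⁴/(η₂²η₆²)`, `Σ(36/δ)r = −12`). [cite: Apostol1990, Thm. 3.4] -/
theorem h1_smul_W36 (τ : ℍ) :
    etaQuotient 72 (expFn [(2, -2), (4, 4), (6, 2)]) (W • τ) = -((36 * (τ : ℂ) + 1) ^ 2 * etaQuotient 72 (expFn [(2, -2), (4, 4), (6, 2)]) τ) :=
  smul_W36_of_factor W h00 h01 h10 h11 [(2, -2), (4, 4), (6, 2)] [(2, -2), (4, 4), (6, -2)] (by decide) (by decide) (by decide) (by decide) τ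

/-- **`h₂(W₃₆τ) = −(36τ+1)²h₂(τ)`** (`u′ = η₂⁴η₁₂²/(η₄²η₆⁴)`, `Σ(36/δ)r = 36`). [cite: Apostol1990, Thm. 3.4] -/
theorem h2_smul_W36 (τ : ℍ) :
    etaQuotient 72 (expFn [(2, 4), (4, -2), (12, 2)]) (W • τ) = -((36 * (τ : ℂ) + 1) ^ 2 * etaQuotient 72 (expFn [(2, 4), (4, -2), (12, 2)]) τ) :=
  smul_W36_of_factor W h00 h01 h10 h11 [(2, 4), (4, -2), (12, 2)] [(2, 4), (4, -2), (6, -4), (12, 2)] (by decide) (by decide) (by decide) (by decide) τ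

/-- **`h₃(W₃₆τ) = −(36τ+1)²h₃(τ)`** (`u′ = η₁₂⁴/η₆⁴`, `Σ(36/δ)r = −12`). [cite: Apostol1990, Thm. 3.4] -/
theorem h3_smul_W36 (τ : ℍ) :
    etaQuotient 72 (expFn [(12, 4)]) (W • τ) = -((36 * (τ : ℂ) + 1) ^ 2 * etaQuotient 72 (expFn [(12, 4)]) τ) :=
  smul_W36_of_factor W h00 h01 h10 h11 [(12, 4)] [(6, -4), (12, 4)] (by decide) (by decide) (by decide) (by decide) τ

/-- **`f₂₄(W₃₆τ) = −(36τ+1)²f₂₄(τ)`** (`f₂₄ = η₂η₄η₆η₁₂`, `u′ = η₂η₄η₁₂/η₆³`, `Σ(36/δ)r = 12`): the trace to `36` kills `ιf₂₄` too.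
[cite: Apostol1990, Thm. 3.4] -/
theorem f24_smul_W36 (τ : ℍ) :
    etaQuotient 72 (expFn etaList24) (W • τ) = -((36 * (τ : ℂ) + 1) ^ 2 * etaQuotient 72 (expFn etaList24) τ) :=
  smul_W36_of_factor W h00 h01 h10 h11 etaList24 [(2, 1), (4, 1), (6, -3), (12, 1)] (by decide) (by decide) (by decide) (by decide) τ

end W36

section W24

/-- The `W₂₄`/`W₄₈`-law for an `η`-quotient `h = u·f₂₄` of level `72` supported on the divisors of `24`, `u` of weight `0`:
`h(Wτ) = e^{−(πi/12)Σ(c/δ)r_δ(u)}(cτ+1)²h(τ)` for `W = (1 0; c 1)`, `24 ∣ c` (`u` re-levelled to level `c`, `f₂₄|W = f₂₄`).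
[cite: Apostol1990, Thm. 3.4] -/
theorem smul_lowerUnipotent_of_factor (c : ℕ) (hc : 24 ∣ c) (hc0 : 0 < c) (L Lu : List (ℕ × ℤ))
    (hL : ∀ t ∈ Nat.divisors 72, t ∉ Nat.divisors 24 → expFn L t = 0)
    (hLu : ∀ t ∈ Nat.divisors c, t ∉ Nat.divisors 24 → expFn Lu t = 0)
    (hmul : ∀ δ ∈ Nat.divisors 24, expFn L δ = expFn Lu δ + expFn etaList24 δ)
    (hsum : ∑ t ∈ Nat.divisors c, expFn Lu t = 0)
    (W : SL(2, ℤ)) (h00 : W 0 0 = 1) (h01 : W 0 1 = 0) (h10 : W 1 0 = c) (h11 : W 1 1 = 1) (τ : ℍ) :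
    etaQuotient 72 (expFn L) (W • τ)
      = cexp (-(π * I / 12 * ((∑ t ∈ c.divisors, ((c / t : ℕ) : ℤ) * expFn Lu t : ℤ) : ℂ))) * ((c : ℂ) * (τ : ℂ) + 1) ^ 2
        * etaQuotient 72 (expFn L) τ := by
  have hW : W ∈ Gamma0 24 := mem_Gamma0_of_entry W h10 (by exact_mod_cast hc)
  have hu : ∀ σ : ℍ, etaQuotient 24 (expFn Lu) σ = etaQuotient c (expFn Lu) σ :=
    fun σ ↦ (etaQuotient_eq_of_dvd_of_support hc hc0.ne' Lu hLu σ).symm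
  rw [etaQuotient_eq_of_dvd_of_support (by norm_num : 24 ∣ 72) (by norm_num) L hL,
    etaQuotient_eq_of_dvd_of_support (by norm_num : 24 ∣ 72) (by norm_num) L hL,
    etaQuotient_eq_mul_of_expFn 24 L Lu etaList24 hmul, etaQuotient_eq_mul_of_expFn 24 L Lu etaList24 hmul, hu, hu,
    show etaQuotient 24 (expFn etaList24) (W • τ) = cuspFormEta24 (W • τ) from rfl,
    show etaQuotient 24 (expFn etaList24) τ = cuspFormEta24 τ from rfl, f24_smul_of_mem W hW, h10, h11,
    etaQuotient_smul_lowerUnipotent c hc0 _ hsum W h00 h01 h10 h11 τ]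
  push_cast
  ring

/-- **`h₁` under `W₂₄`, `W₄₈`**: factors `e^{−(πi/12)(−16)}`, `e^{−(πi/12)(−32)}` (`u = η₄³η₆/(η₂³η₁₂)`). [cite: Apostol1990, Thm. 3.4] -/
theorem h1_smul_W24 (W : SL(2, ℤ)) (h00 : W 0 0 = 1) (h01 : W 0 1 = 0) (h10 : W 1 0 = 24) (h11 : W 1 1 = 1) (τ : ℍ) :
    etaQuotient 72 (expFn [(2, -2), (4, 4), (6, 2)]) (W • τ)
      = cexp (-(π * I / 12 * ((-16 : ℤ) : ℂ))) * (24 * (τ : ℂ) + 1) ^ 2 * etaQuotient 72 (expFn [(2, -2), (4, 4), (6, 2)]) τ := by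
  have h := smul_lowerUnipotent_of_factor 24 (by norm_num) (by norm_num) [(2, -2), (4, 4), (6, 2)] [(2, -3), (4, 3), (6, 1), (12, -1)]
    (by decide) (by decide) (by decide) (by decide) W h00 h01 (by rw [h10]; norm_num) h11 τ
  rw [h, show (∑ t ∈ Nat.divisors 24, ((24 / t : ℕ) : ℤ) * expFn [(2, -3), (4, 3), (6, 1), (12, -1)] t : ℤ) = -16 by decide]
  push_cast
  ring

/-- `h₁` under `W₄₈`. [cite: Apostol1990, Thm. 3.4] -/
theorem h1_smul_W48 (W : SL(2, ℤ)) (h00 : W 0 0 = 1) (h01 : W 0 1 = 0) (h10 : W 1 0 = 48) (h11 : W 1 1 = 1) (τ : ℍ) :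
    etaQuotient 72 (expFn [(2, -2), (4, 4), (6, 2)]) (W • τ)
      = cexp (-(π * I / 12 * ((2 * (-16) : ℤ) : ℂ))) * (48 * (τ : ℂ) + 1) ^ 2 * etaQuotient 72 (expFn [(2, -2), (4, 4), (6, 2)]) τ := by
  have h := smul_lowerUnipotent_of_factor 48 (by norm_num) (by norm_num) [(2, -2), (4, 4), (6, 2)] [(2, -3), (4, 3), (6, 1), (12, -1)]
    (by decide) (by decide) (by decide) (by decide) W h00 h01 (by rw [h10]; norm_num) h11 τ
  rw [h, show (∑ t ∈ Nat.divisors 48, ((48 / t : ℕ) : ℤ) * expFn [(2, -3), (4, 3), (6, 1), (12, -1)] t : ℤ) = 2 * (-16) by decide]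
  push_cast
  ring

/-- `h₂` under `W₂₄` (`u = η₂³η₁₂/(η₄³η₆)`, `Σ(24/δ)r = 16`). [cite: Apostol1990, Thm. 3.4] -/
theorem h2_smul_W24 (W : SL(2, ℤ)) (h00 : W 0 0 = 1) (h01 : W 0 1 = 0) (h10 : W 1 0 = 24) (h11 : W 1 1 = 1) (τ : ℍ) :
    etaQuotient 72 (expFn [(2, 4), (4, -2), (12, 2)]) (W • τ)
      = cexp (-(π * I / 12 * ((16 : ℤ) : ℂ))) * (24 * (τ : ℂ) + 1) ^ 2 * etaQuotient 72 (expFn [(2, 4), (4, -2), (12, 2)]) τ := by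
  have h := smul_lowerUnipotent_of_factor 24 (by norm_num) (by norm_num) [(2, 4), (4, -2), (12, 2)] [(2, 3), (4, -3), (6, -1), (12, 1)]
    (by decide) (by decide) (by decide) (by decide) W h00 h01 (by rw [h10]; norm_num) h11 τ
  rw [h, show (∑ t ∈ Nat.divisors 24, ((24 / t : ℕ) : ℤ) * expFn [(2, 3), (4, -3), (6, -1), (12, 1)] t : ℤ) = 16 by decide]
  push_cast
  ring

/-- `h₂` under `W₄₈`. [cite: Apostol1990, Thm. 3.4] -/
theorem h2_smul_W48 (W : SL(2, ℤ)) (h00 : W 0 0 = 1) (h01 : W 0 1 = 0) (h10 : W 1 0 = 48) (h11 : W 1 1 = 1) (τ : ℍ) :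
    etaQuotient 72 (expFn [(2, 4), (4, -2), (12, 2)]) (W • τ)
      = cexp (-(π * I / 12 * ((2 * 16 : ℤ) : ℂ))) * (48 * (τ : ℂ) + 1) ^ 2 * etaQuotient 72 (expFn [(2, 4), (4, -2), (12, 2)]) τ := by
  have h := smul_lowerUnipotent_of_factor 48 (by norm_num) (by norm_num) [(2, 4), (4, -2), (12, 2)] [(2, 3), (4, -3), (6, -1), (12, 1)]
    (by decide) (by decide) (by decide) (by decide) W h00 h01 (by rw [h10]; norm_num) h11 τ
  rw [h, show (∑ t ∈ Nat.divisors 48, ((48 / t : ℕ) : ℤ) * expFn [(2, 3), (4, -3), (6, -1), (12, 1)] t : ℤ) = 2 * 16 by decide]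
  push_cast
  ring

/-- `h₃` under `W₂₄` (`u = η₁₂³/(η₂η₄η₆)`, `Σ(24/δ)r = −16`). [cite: Apostol1990, Thm. 3.4] -/
theorem h3_smul_W24 (W : SL(2, ℤ)) (h00 : W 0 0 = 1) (h01 : W 0 1 = 0) (h10 : W 1 0 = 24) (h11 : W 1 1 = 1) (τ : ℍ) :
    etaQuotient 72 (expFn [(12, 4)]) (W • τ)
      = cexp (-(π * I / 12 * ((-16 : ℤ) : ℂ))) * (24 * (τ : ℂ) + 1) ^ 2 * etaQuotient 72 (expFn [(12, 4)]) τ := by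
  have h := smul_lowerUnipotent_of_factor 24 (by norm_num) (by norm_num) [(12, 4)] [(2, -1), (4, -1), (6, -1), (12, 3)]
    (by decide) (by decide) (by decide) (by decide) W h00 h01 (by rw [h10]; norm_num) h11 τ
  rw [h, show (∑ t ∈ Nat.divisors 24, ((24 / t : ℕ) : ℤ) * expFn [(2, -1), (4, -1), (6, -1), (12, 3)] t : ℤ) = -16 by decide]
  push_cast
  ring

/-- `h₃` under `W₄₈`. [cite: Apostol1990, Thm. 3.4] -/
theorem h3_smul_W48 (W : SL(2, ℤ)) (h00 : W 0 0 = 1) (h01 : W 0 1 = 0) (h10 : W 1 0 = 48) (h11 : W 1 1 = 1) (τ : ℍ) :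
    etaQuotient 72 (expFn [(12, 4)]) (W • τ)
      = cexp (-(π * I / 12 * ((2 * (-16) : ℤ) : ℂ))) * (48 * (τ : ℂ) + 1) ^ 2 * etaQuotient 72 (expFn [(12, 4)]) τ := by
  have h := smul_lowerUnipotent_of_factor 48 (by norm_num) (by norm_num) [(12, 4)] [(2, -1), (4, -1), (6, -1), (12, 3)]
    (by decide) (by decide) (by decide) (by decide) W h00 h01 (by rw [h10]; norm_num) h11 τ
  rw [h, show (∑ t ∈ Nat.divisors 48, ((48 / t : ℕ) : ℤ) * expFn [(2, -1), (4, -1), (6, -1), (12, 3)] t : ℤ) = 2 * (-16) by decide]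
  push_cast
  ring

end W24

/-! ## §5 The traces kill `h₁, h₂, h₃` (and `Tr₃₆` kills `f₂₄` viewed at level `72`) -/

/-- **`Tr₃₆` and `Tr₂₄` kill any cusp form on `Γ₀(72)` with function `h₁`.** [cite: DiamondShurman2005, §5.1] -/
theorem traces_h1 (H : CuspForm (Gamma0 72) 2) (hH : ⇑H = etaQuotient 72 (expFn [(2, -2), (4, 4), (6, 2)])) :
    adjDegeneracyMap0 72 36 1 2 H = 0 ∧ adjDegeneracyMap0 72 24 1 2 H = 0 :=
  ⟨adjDegeneracyMap0_thirtySix_eq_zero_of_smul_W H fun W a b c d τ ↦ by rw [hH, h1_smul_W36 W a b c d],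
    adjDegeneracyMap0_twentyFour_eq_zero_of_smul_W H _ _ (one_add_cexp_add_cexp_eq_zero (-16) (Or.inl ⟨-1, by norm_num⟩))
      (fun W a b c d τ ↦ by rw [hH, h1_smul_W24 W a b c d]) (fun W a b c d τ ↦ by rw [hH, h1_smul_W48 W a b c d])⟩

/-- **`Tr₃₆` and `Tr₂₄` kill any cusp form with function `h₂`.** [cite: DiamondShurman2005, §5.1] -/
theorem traces_h2 (H : CuspForm (Gamma0 72) 2) (hH : ⇑H = etaQuotient 72 (expFn [(2, 4), (4, -2), (12, 2)])) :
    adjDegeneracyMap0 72 36 1 2 H = 0 ∧ adjDegeneracyMap0 72 24 1 2 H = 0 :=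
  ⟨adjDegeneracyMap0_thirtySix_eq_zero_of_smul_W H fun W a b c d τ ↦ by rw [hH, h2_smul_W36 W a b c d],
    adjDegeneracyMap0_twentyFour_eq_zero_of_smul_W H _ _ (one_add_cexp_add_cexp_eq_zero 16 (Or.inr ⟨0, by norm_num⟩))
      (fun W a b c d τ ↦ by rw [hH, h2_smul_W24 W a b c d]) (fun W a b c d τ ↦ by rw [hH, h2_smul_W48 W a b c d])⟩

/-- **`Tr₃₆` and `Tr₂₄` kill any cusp form with function `h₃ = η₁₂⁴`.** [cite: DiamondShurman2005, §5.1] -/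
theorem traces_h3 (H : CuspForm (Gamma0 72) 2) (hH : ⇑H = etaQuotient 72 (expFn [(12, 4)])) :
    adjDegeneracyMap0 72 36 1 2 H = 0 ∧ adjDegeneracyMap0 72 24 1 2 H = 0 :=
  ⟨adjDegeneracyMap0_thirtySix_eq_zero_of_smul_W H fun W a b c d τ ↦ by rw [hH, h3_smul_W36 W a b c d],
    adjDegeneracyMap0_twentyFour_eq_zero_of_smul_W H _ _ (one_add_cexp_add_cexp_eq_zero (-16) (Or.inl ⟨-1, by norm_num⟩))
      (fun W a b c d τ ↦ by rw [hH, h3_smul_W24 W a b c d]) (fun W a b c d τ ↦ by rw [hH, h3_smul_W48 W a b c d])⟩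

/-- **`Tr₃₆` kills `f₂₄` viewed at level `72`** (`ι₁f₂₄`, function `η₂η₄η₆η₁₂`). [cite: DiamondShurman2005, §5.1] -/
theorem adjDegeneracyMap0_thirtySix_f24 (A : CuspForm (Gamma0 72) 2) (hA : ⇑A = etaQuotient 72 (expFn etaList24)) :
    adjDegeneracyMap0 72 36 1 2 A = 0 :=
  adjDegeneracyMap0_thirtySix_eq_zero_of_smul_W A fun W a b c d τ ↦ by rw [hA, f24_smul_W36 W a b c d]

end Summit.BirchSwinnertonDyer.BirchSwinnertonDyer.Theorems.ManinLocalTwoThree.NewformSeventyTwo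

end
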